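import Literature.NumberTheory.Sieve.FGKMT2018SieveWeightsStructure
import HarnessLib

/-!
# FGKMT 2018 (7.6)–(7.7) / Maynard 2016 §8: the singular series `𝔖_D(𝓛)` of an admissible
NON-DEGENERATE family converges and is positive

Source: K. Ford, B. Green, S. Konyagin, J. Maynard, T. Tao, *Long gaps between primes*, J. Amer.
Math. Soc. 31 (2018), §7 (7.6)–(7.7) p. 21 [FordGreenKonyaginMaynardTao2018]; J. Maynard, *Dense
clusters of primes in subsets*, Compositio Math. 152 (2016), §7 p. 13 («since the `L_i` are distinct,
`ω(p) = k` for all `p ∤ ∏ a_i ∏_{i≠j} (a_i b_j − b_i a_j)`») and Lemma 8.1 [Maynard2016DenseClusters].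

`FGKMT2018MultidimensionalSieve` renders `𝔖_D(𝓛) = ∏_{p ∤ D} (1 − ω_𝓛(p)/p)(1 − 1/p)^{-k}` as
`singSeriesExcl L D := limUnder atTop (singPartial L D)`; the named facts
`FordGreenKonyaginMaynardTao2018_theorem6ZN`, `Maynard2016DenseClusters_prop61Z` make claims about
this number for every admissible non-degenerate family (`FormsAdmissible`, `FormsNondegenerate`).
This file proves that for such families the limit EXISTS and is positive, with explicit two-sided
tail bounds — the first lemma the proof of Proposition 6.1 needs (blueprint E2-SPEC §4, risk 1), and
the general counterpart of the special cases `tendsto_singPartial_tupleForms`,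
`tendsto_singPartial_wbpForms` of `FGKMT2018SingularSeriesExcl`.

* `omegaL_eq_card_of_not_dvd`: for a prime `p ∤ a_i` (all `i`) and `p ∤ a_i b_j − a_j b_i`
  (all `i ≠ j`), `ω_𝓛(p) = k` (the roots `−b_i/a_i mod p` are distinct);
  `exists_forall_omegaL_eq_card`: for admissible non-degenerate `𝓛`, `ω_𝓛(p) = k` for all large `p`.
* `singFactor_le_one_of_omegaL_eq`, `one_sub_le_singFactor_of_omegaL_eq`: if `ω(p) = k ≤ p` then
  `1 − k²/p² ≤ (1 − k/p)(1 − 1/p)^{-k} ≤ 1` (Bernoulli); `singFactor_pos_of_omegaL_lt`;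
  `singPartial_succ`, `singPartial_pos_of_admissible`.
* `singPartial_add_ge`: past such a `P₀ ≥ max(1, 2k)` the partial products satisfy
  `𝔖_D(𝓛; P₀) e^{−2k²(1/P₀ − 1/(P₀+m))} ≤ 𝔖_D(𝓛; P₀ + m) ≤ 𝔖_D(𝓛; P₀)`.
* `singSeriesExcl_bounds_of_forall_omegaL_eq`: the partial products converge to `singSeriesExcl L D`
  and `𝔖_D(𝓛; P₀) e^{−2k²/P₀} ≤ 𝔖_D(𝓛) ≤ 𝔖_D(𝓛; P₀)`;
  `tendsto_singPartial_of_nondegenerate`, `singSeriesExcl_pos_of_nondegenerate`.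

## References
* [FordGreenKonyaginMaynardTao2018] §7 (7.6)–(7.7), p. 21.
* [Maynard2016DenseClusters] §7 p. 13 and Lemma 8.1 p. 15.
-/

noncomputable section

open Finset Filter Topology

namespace Literature.NumberTheory.Sieve.FGKMT2018

variable {k : ℕ}

/-! ### `ω_𝓛(p) = k` off the exceptional primes -/

/-- **`ω_𝓛(p) = k` for the non-exceptional primes**: if `p` is a prime with `p ∤ a_i` for all `i`
and `p ∤ a_i b_j − a_j b_i` for all `i ≠ j`, then `∏ L_i` has exactly `k` roots mod `p` (the roots
`−b_i a_i^{-1}` are pairwise distinct). [cite: Maynard2016DenseClusters, §7 p. 13] -/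
theorem omegaL_eq_card_of_not_dvd (L : Fin k → ℤ × ℤ) {p : ℕ} (hp : p.Prime)
    (ha : ∀ i, ¬ (p : ℤ) ∣ (L i).1)
    (hnd : ∀ i j, i ≠ j → ¬ (p : ℤ) ∣ (L i).1 * (L j).2 - (L j).1 * (L i).2) :
    omegaL L p = k := by
  haveI := Fact.mk hp
  rw [omegaL_eq_card_zmod]
  have ha' : ∀ i, (((L i).1 : ℤ) : ZMod p) ≠ 0 := fun i h =>
    ha i ((ZMod.intCast_zmod_eq_zero_iff_dvd _ p).mp h)
  set r : Fin k → ZMod p := fun i => -(((L i).2 : ℤ) : ZMod p) / (((L i).1 : ℤ) : ZMod p) with hr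
  have hinj : Function.Injective r := by
    intro i j hij
    by_contra hne
    have h1 : -(((L i).2 : ℤ) : ZMod p) * (((L j).1 : ℤ) : ZMod p)
        = -(((L j).2 : ℤ) : ZMod p) * (((L i).1 : ℤ) : ZMod p) :=
      (div_eq_div_iff (ha' i) (ha' j)).mp hij
    have h2 : (((L i).1 * (L j).2 - (L j).1 * (L i).2 : ℤ) : ZMod p) = 0 := by
      push_cast
      linear_combination h1
    exact hnd i j hne ((ZMod.intCast_zmod_eq_zero_iff_dvd _ p).mp h2)
  have hset : (Finset.univ.filter fun x : ZMod p => ∏ i, formMod (L i) p x = 0)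
      = Finset.univ.image r := by
    ext x
    simp only [Finset.mem_filter, Finset.mem_univ, true_and, Finset.mem_image,
      Finset.prod_eq_zero_iff, formMod]
    constructor
    · rintro ⟨i, hi⟩
      refine ⟨i, ?_⟩
      have h3 : (((L i).1 : ℤ) : ZMod p) * x = -(((L i).2 : ℤ) : ZMod p) :=
        eq_neg_of_add_eq_zero_left hi
      rw [hr]
      exact ((eq_div_iff (ha' i)).mpr (by rw [mul_comm]; exact h3)).symm
    · rintro ⟨i, hi⟩
      refine ⟨i, ?_⟩
      rw [← hi, hr]
      simp only
      rw [mul_comm, div_mul_cancel₀ _ (ha' i), neg_add_cancel]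
  rw [hset, Finset.card_image_of_injective _ hinj, Finset.card_univ, Fintype.card_fin]

/-- **`ω_𝓛(p) = k` for all large `p`** when `𝓛` is admissible (`a_i ≠ 0`) and non-degenerate
(`a_i b_j ≠ a_j b_i`): one may take `P₀ = ∏_i (|a_i| ∏_{j ≠ i} |a_i b_j − a_j b_i|)`.
[cite: Maynard2016DenseClusters, §7 p. 13] -/
theorem exists_forall_omegaL_eq_card {L : Fin k → ℤ × ℤ} (hadm : FormsAdmissible L)
    (hnd : FormsNondegenerate L) :
    ∃ P₀ : ℕ, ∀ p : ℕ, p.Prime → P₀ < p → omegaL L p = k := by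
  classical
  set P₀ : ℕ := ∏ i, ((L i).1.natAbs *
    ∏ j, (if i = j then 1 else ((L i).1 * (L j).2 - (L j).1 * (L i).2).natAbs)) with hP₀
  have hfac_pos : ∀ i, 0 < (L i).1.natAbs *
      ∏ j, (if i = j then 1 else ((L i).1 * (L j).2 - (L j).1 * (L i).2).natAbs) := by
    intro i
    refine Nat.mul_pos (Int.natAbs_pos.mpr (hadm.1 i)) (Finset.prod_pos fun j _ => ?_)
    split_ifs with hij
    · exact Nat.one_pos
    · exact Int.natAbs_pos.mpr (sub_ne_zero.mpr (hnd i j hij))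
  have hP₀pos : 0 < P₀ := Finset.prod_pos fun i _ => hfac_pos i
  refine ⟨P₀, fun p hp hlt => omegaL_eq_card_of_not_dvd L hp (fun i hdvd => ?_) (fun i j hij hdvd => ?_)⟩
  · -- `p ∣ a_i` forces `p ≤ |a_i| ≤ P₀ < p`
    have h1 : p ∣ (L i).1.natAbs := by
      have := Int.natAbs_dvd_natAbs.mpr hdvd
      simpa only [Int.natAbs_natCast] using this
    have h2 : (L i).1.natAbs ∣ P₀ := by
      rw [hP₀]
      exact Dvd.dvd.trans (Dvd.intro _ rfl) (Finset.dvd_prod_of_mem _ (Finset.mem_univ i))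
    exact absurd (Nat.le_of_dvd hP₀pos (h1.trans h2)) (not_le.mpr hlt)
  · have h1 : p ∣ ((L i).1 * (L j).2 - (L j).1 * (L i).2).natAbs := by
      have := Int.natAbs_dvd_natAbs.mpr hdvd
      simpa only [Int.natAbs_natCast] using this
    have h2 : ((L i).1 * (L j).2 - (L j).1 * (L i).2).natAbs ∣ P₀ := by
      rw [hP₀]
      refine Dvd.dvd.trans ?_ (Finset.dvd_prod_of_mem _ (Finset.mem_univ i))
      refine Dvd.dvd.trans ?_ (Dvd.intro_left _ rfl)
      have := Finset.dvd_prod_of_mem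
        (fun j' => if i = j' then 1 else ((L i).1 * (L j').2 - (L j').1 * (L i).2).natAbs)
        (Finset.mem_univ j)
      simpa only [if_neg hij] using this
    exact absurd (Nat.le_of_dvd hP₀pos (h1.trans h2)) (not_le.mpr hlt)

/-! ### Size of the Euler factors -/

/-- `0 < (1 − ω(p)/p)(1 − 1/p)^{-k}` when `ω(p) < p` (e.g. `𝓛` admissible) and `p ≥ 2`.
[cite: FordGreenKonyaginMaynardTao2018, (7.6) p. 21] -/
theorem singFactor_pos_of_omegaL_lt (L : Fin k → ℤ × ℤ) {p : ℕ} (hp : 2 ≤ p)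
    (hω : omegaL L p < p) : 0 < singFactor L p := by
  unfold singFactor
  have hp0 : (0 : ℝ) < p := by exact_mod_cast (by omega : 0 < p)
  refine mul_pos ?_ (pow_pos (inv_pos.mpr ?_) _)
  · rw [sub_pos, div_lt_one hp0]; exact_mod_cast hω
  · rw [sub_pos, div_lt_one hp0]; exact_mod_cast (by omega : 1 < p)

/-- **Upper bound** `(1 − k/p)(1 − 1/p)^{-k} ≤ 1` when `ω(p) = k`, `p ≥ 2` (Bernoulli:
`1 − k/p ≤ (1 − 1/p)^k`). [cite: Maynard2016DenseClusters, Lemma 8.1 p. 15] -/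
theorem singFactor_le_one_of_omegaL_eq (L : Fin k → ℤ × ℤ) {p : ℕ} (hp : 2 ≤ p)
    (hω : omegaL L p = k) : singFactor L p ≤ 1 := by
  unfold singFactor
  rw [hω]
  have hp0 : (0 : ℝ) < p := by exact_mod_cast (by omega : 0 < p)
  have hq : 0 < 1 - 1 / (p : ℝ) := by
    rw [sub_pos, div_lt_one hp0]; exact_mod_cast (by omega : 1 < p)
  rw [inv_pow, ← div_eq_mul_inv, div_le_one (pow_pos hq k)]
  have hB := one_add_mul_le_pow (show (-2 : ℝ) ≤ -(1 / (p : ℝ)) by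
    have : (1 : ℝ) / p ≤ 1 := (div_le_one hp0).mpr (by exact_mod_cast (by omega : 1 ≤ p))
    linarith) k
  convert hB using 1 <;> ring

/-- **Lower bound** `1 − k²/p² ≤ (1 − k/p)(1 − 1/p)^{-k}` when `ω(p) = k ≤ p`, `p ≥ 2`
(`(1 − 1/p)^{-k} ≥ (1 + 1/p)^k ≥ 1 + k/p`). [cite: Maynard2016DenseClusters, Lemma 8.1 p. 15] -/
theorem one_sub_le_singFactor_of_omegaL_eq (L : Fin k → ℤ × ℤ) {p : ℕ} (hp : 2 ≤ p)
    (hkp : k ≤ p) (hω : omegaL L p = k) :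
    1 - (k : ℝ) ^ 2 / (p : ℝ) ^ 2 ≤ singFactor L p := by
  unfold singFactor
  rw [hω]
  have hp0 : (0 : ℝ) < p := by exact_mod_cast (by omega : 0 < p)
  have hq : 0 < 1 - 1 / (p : ℝ) := by
    rw [sub_pos, div_lt_one hp0]; exact_mod_cast (by omega : 1 < p)
  have h1 : 0 ≤ 1 - (k : ℝ) / p := by
    rw [sub_nonneg, div_le_one hp0]; exact_mod_cast hkp
  have h3 : 1 + 1 / (p : ℝ) ≤ (1 - 1 / (p : ℝ))⁻¹ := by
    rw [← one_div, le_div_iff₀ hq]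
    have e : (1 + 1 / (p : ℝ)) * (1 - 1 / p) = 1 - 1 / (p : ℝ) ^ 2 := by ring
    rw [e]
    have : (0 : ℝ) ≤ 1 / (p : ℝ) ^ 2 := by positivity
    linarith
  have h2 : 1 + (k : ℝ) / p ≤ (1 - 1 / (p : ℝ))⁻¹ ^ k :=
    calc 1 + (k : ℝ) / p = 1 + k * (1 / (p : ℝ)) := by ring
      _ ≤ (1 + 1 / (p : ℝ)) ^ k :=
          one_add_mul_le_pow (by linarith [show (0 : ℝ) ≤ 1 / (p : ℝ) from by positivity]) k
      _ ≤ (1 - 1 / (p : ℝ))⁻¹ ^ k := by gcongr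
  calc 1 - (k : ℝ) ^ 2 / (p : ℝ) ^ 2 = (1 - k / p) * (1 + k / p) := by ring
    _ ≤ (1 - (k : ℝ) / p) * (1 - 1 / (p : ℝ))⁻¹ ^ k := mul_le_mul_of_nonneg_left h2 h1

/-! ### Partial products -/

/-- One more prime in the partial product `𝔖_D(𝓛; x) = ∏_{p ≤ x, p ∤ D} (…)`.
[cite: FordGreenKonyaginMaynardTao2018, (7.6) p. 21] -/
theorem singPartial_succ (L : Fin k → ℤ × ℤ) (D x : ℕ) :
    singPartial L D (x + 1) = singPartial L D x *
      (if (x + 1).Prime ∧ ¬ (x + 1) ∣ D then singFactor L (x + 1) else 1) := by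
  unfold singPartial
  rw [Finset.prod_filter, Finset.prod_filter, Finset.prod_range_succ]

/-- The partial products of an admissible family are positive.
[cite: FordGreenKonyaginMaynardTao2018, (7.6) p. 21] -/
theorem singPartial_pos_of_admissible {L : Fin k → ℤ × ℤ} (hadm : FormsAdmissible L) (D x : ℕ) :
    0 < singPartial L D x := by
  unfold singPartial
  refine Finset.prod_pos fun p hp => ?_
  rw [Finset.mem_filter] at hp
  exact singFactor_pos_of_omegaL_lt L hp.2.1.two_le (((formsAdmissible_iff_omegaL L).mp hadm).2 p hp.2.1)

/-- `e^{−2t} ≤ 1 − t` for `0 ≤ t ≤ 1/2` (from `1 + 2t ≤ e^{2t}`). [folklore] -/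
private theorem exp_neg_two_mul_le {t : ℝ} (h0 : 0 ≤ t) (h1 : t ≤ 1 / 2) :
    Real.exp (-(2 * t)) ≤ 1 - t := by
  have h2 : 1 + 2 * t ≤ Real.exp (2 * t) := by linarith [Real.add_one_le_exp (2 * t)]
  have hpos : (0 : ℝ) < 1 + 2 * t := by linarith
  rw [Real.exp_neg]
  calc (Real.exp (2 * t))⁻¹ ≤ (1 + 2 * t)⁻¹ := by
        rw [inv_le_inv₀ (Real.exp_pos _) hpos]; exact h2
    _ ≤ 1 - t := by
        rw [inv_le_iff_one_le_mul₀ hpos]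
        nlinarith

/-- **Tail control past the exceptional primes.** If `P₀ ≥ max(1, 2k)` and `ω_𝓛(p) = k` for every
prime `p > P₀`, then for an admissible `𝓛` and every `m`,
`𝔖_D(𝓛; P₀) · exp(−2k²(1/P₀ − 1/(P₀+m))) ≤ 𝔖_D(𝓛; P₀+m) ≤ 𝔖_D(𝓛; P₀)`
(each new factor lies in `[1 − k²/p², 1] ⊂ [e^{−2k²/p²}, 1]` and `1/p² ≤ 1/(p−1) − 1/p`).
[cite: Maynard2016DenseClusters, Lemma 8.1 p. 15] -/
theorem singPartial_add_ge {L : Fin k → ℤ × ℤ} (hadm : FormsAdmissible L) {P₀ : ℕ} (hP1 : 1 ≤ P₀)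
    (hPk : 2 * k ≤ P₀) (hP : ∀ p : ℕ, p.Prime → P₀ < p → omegaL L p = k) (D m : ℕ) :
    singPartial L D P₀ * Real.exp (-(2 * (k : ℝ) ^ 2 * (1 / (P₀ : ℝ) - 1 / ((P₀ + m : ℕ) : ℝ))))
        ≤ singPartial L D (P₀ + m) ∧
      singPartial L D (P₀ + m) ≤ singPartial L D P₀ := by
  induction m with
  | zero => simp
  | succ m ih =>
    obtain ⟨ih1, ih2⟩ := ih
    set n : ℕ := P₀ + m with hn
    have hPm : P₀ + (m + 1) = n + 1 := by rw [hn, Nat.add_assoc]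
    rw [hPm, singPartial_succ]
    have hn1 : 1 ≤ n := le_trans hP1 (Nat.le_add_right _ _)
    have hnR : (1 : ℝ) ≤ n := by exact_mod_cast hn1
    have hcast : ((n + 1 : ℕ) : ℝ) = (n : ℝ) + 1 := by push_cast; ring
    have hSn : 0 ≤ singPartial L D n := (singPartial_pos_of_admissible hadm D n).le
    -- the new factor `c` satisfies `exp(−2k²(1/n − 1/(n+1))) ≤ c ≤ 1`
    have hc_le : (if (n + 1).Prime ∧ ¬ (n + 1) ∣ D then singFactor L (n + 1) else 1) ≤ 1 := by
      split_ifs with hc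
      · exact singFactor_le_one_of_omegaL_eq L (by omega) (hP _ hc.1 (by omega))
      · exact le_rfl
    have hdiff : 0 ≤ 1 / (n : ℝ) - 1 / ((n : ℝ) + 1) := by
      rw [sub_nonneg]
      exact one_div_le_one_div_of_le (by linarith) (by linarith)
    have hc_ge : Real.exp (-(2 * (k : ℝ) ^ 2 * (1 / (n : ℝ) - 1 / ((n : ℝ) + 1))))
        ≤ (if (n + 1).Prime ∧ ¬ (n + 1) ∣ D then singFactor L (n + 1) else 1) := by
      split_ifs with hc
      · have hω := hP _ hc.1 (by omega)
        have hb := one_sub_le_singFactor_of_omegaL_eq L (by omega : 2 ≤ n + 1) (by omega : k ≤ n + 1) hω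
        rw [hcast] at hb
        refine le_trans ?_ hb
        have ht0 : (0 : ℝ) ≤ (k : ℝ) ^ 2 / ((n : ℝ) + 1) ^ 2 := by positivity
        have h2k : (2 * k : ℝ) ≤ (n : ℝ) + 1 := by exact_mod_cast (by omega : 2 * k ≤ n + 1)
        have ht1 : (k : ℝ) ^ 2 / ((n : ℝ) + 1) ^ 2 ≤ 1 / 2 := by
          rw [div_le_iff₀ (by positivity)]
          nlinarith [sq_nonneg (k : ℝ)]
        refine le_trans (Real.exp_le_exp.mpr ?_) (exp_neg_two_mul_le ht0 ht1)
        -- `−2k²(1/n − 1/(n+1)) ≤ −2 (k²/(n+1)²)` since `1/(n+1)² ≤ 1/n − 1/(n+1)`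
        have key : 1 / ((n : ℝ) + 1) ^ 2 ≤ 1 / (n : ℝ) - 1 / ((n : ℝ) + 1) := by
          rw [div_sub_div _ _ (by positivity) (by positivity),
            div_le_div_iff₀ (by positivity) (by positivity)]
          nlinarith
        have := mul_le_mul_of_nonneg_left key (by positivity : (0 : ℝ) ≤ 2 * (k : ℝ) ^ 2)
        have e1 : 2 * ((k : ℝ) ^ 2 / ((n : ℝ) + 1) ^ 2) = 2 * (k : ℝ) ^ 2 * (1 / ((n : ℝ) + 1) ^ 2) := by
          ring
        linarith
      · exact Real.exp_le_one_iff.mpr (neg_nonpos.mpr (mul_nonneg (by positivity) hdiff))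
    refine ⟨?_, ?_⟩
    · -- lower bound: split the exponential
      have hsplit : Real.exp (-(2 * (k : ℝ) ^ 2 * (1 / (P₀ : ℝ) - 1 / ((n + 1 : ℕ) : ℝ))))
          = Real.exp (-(2 * (k : ℝ) ^ 2 * (1 / (P₀ : ℝ) - 1 / ((n : ℕ) : ℝ))))
            * Real.exp (-(2 * (k : ℝ) ^ 2 * (1 / (n : ℝ) - 1 / ((n : ℝ) + 1)))) := by
        rw [← Real.exp_add, hcast]; ring_nf
      rw [hsplit, ← mul_assoc]
      exact le_trans (mul_le_mul_of_nonneg_right ih1 (Real.exp_pos _).le)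
        (mul_le_mul_of_nonneg_left hc_ge hSn)
    · exact le_trans (mul_le_of_le_one_right hSn hc_le) ih2

/-! ### Convergence and positivity of `𝔖_D(𝓛)` -/

/-- **Convergence with explicit bounds.** If `𝓛` is admissible, `P₀ ≥ max(1, 2k)` and
`ω_𝓛(p) = k` for every prime `p > P₀`, then the partial products converge to `𝔖_D(𝓛) =
singSeriesExcl L D` and `𝔖_D(𝓛; P₀) e^{−2k²/P₀} ≤ 𝔖_D(𝓛) ≤ 𝔖_D(𝓛; P₀)`.
[cite: Maynard2016DenseClusters, Lemma 8.1 p. 15; FordGreenKonyaginMaynardTao2018 (7.6)–(7.7) p. 21] -/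
theorem singSeriesExcl_bounds_of_forall_omegaL_eq {L : Fin k → ℤ × ℤ} (hadm : FormsAdmissible L)
    {P₀ : ℕ} (hP1 : 1 ≤ P₀) (hPk : 2 * k ≤ P₀)
    (hP : ∀ p : ℕ, p.Prime → P₀ < p → omegaL L p = k) (D : ℕ) :
    Tendsto (singPartial L D) atTop (𝓝 (singSeriesExcl L D)) ∧
      singPartial L D P₀ * Real.exp (-(2 * (k : ℝ) ^ 2 / P₀)) ≤ singSeriesExcl L D ∧
      singSeriesExcl L D ≤ singPartial L D P₀ := by
  set g : ℕ → ℝ := fun m => singPartial L D (P₀ + m) with hg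
  have hanti : Antitone g := by
    refine antitone_nat_of_succ_le fun m => ?_
    simp only [hg]
    rw [show P₀ + (m + 1) = (P₀ + m) + 1 from rfl, singPartial_succ]
    refine mul_le_of_le_one_right (singPartial_pos_of_admissible hadm D _).le ?_
    split_ifs with hc
    · exact singFactor_le_one_of_omegaL_eq L (by omega) (hP _ hc.1 (by omega))
    · exact le_rfl
  have hlow : ∀ m, singPartial L D P₀ * Real.exp (-(2 * (k : ℝ) ^ 2 / P₀)) ≤ g m := by
    intro m
    refine le_trans ?_ (singPartial_add_ge hadm hP1 hPk hP D m).1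
    refine mul_le_mul_of_nonneg_left (Real.exp_le_exp.mpr ?_) (singPartial_pos_of_admissible hadm D P₀).le
    have h1 : (0 : ℝ) ≤ 1 / ((P₀ + m : ℕ) : ℝ) := by positivity
    have h2 : (0 : ℝ) ≤ 2 * (k : ℝ) ^ 2 := by positivity
    have e : 2 * (k : ℝ) ^ 2 / P₀ = 2 * (k : ℝ) ^ 2 * (1 / (P₀ : ℝ)) := by ring
    rw [e]
    nlinarith [mul_nonneg h2 h1]
  have hbdd : BddBelow (Set.range g) := ⟨_, by rintro _ ⟨m, rfl⟩; exact hlow m⟩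
  have hglim : Tendsto g atTop (𝓝 (⨅ m, g m)) := tendsto_atTop_ciInf hanti hbdd
  have hflim : Tendsto (singPartial L D) atTop (𝓝 (⨅ m, g m)) := by
    have h' : Tendsto (fun n => singPartial L D (n + P₀)) atTop (𝓝 (⨅ m, g m)) := by
      have : (fun n => singPartial L D (n + P₀)) = g := by
        funext n; simp only [hg, add_comm]
      rw [this]; exact hglim
    exact (tendsto_add_atTop_iff_nat P₀).mp h'
  have heq : singSeriesExcl L D = ⨅ m, g m := hflim.limUnder_eq
  refine ⟨heq ▸ hflim, ?_, ?_⟩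
  · rw [heq]; exact le_ciInf fun m => hlow m
  · rw [heq]
    refine (ciInf_le hbdd 0).trans (le_of_eq ?_)
    simp only [hg, add_zero]

/-- **`𝔖_D(𝓛)` converges** for admissible non-degenerate families: the partial products
`∏_{p ≤ x, p ∤ D} (1 − ω_𝓛(p)/p)(1 − 1/p)^{-k}` tend to `singSeriesExcl L D`.
[cite: FordGreenKonyaginMaynardTao2018, (7.6)–(7.7) p. 21; Maynard2016DenseClusters, §7 p. 13] -/
theorem tendsto_singPartial_of_nondegenerate {L : Fin k → ℤ × ℤ} (hadm : FormsAdmissible L)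
    (hnd : FormsNondegenerate L) (D : ℕ) :
    Tendsto (singPartial L D) atTop (𝓝 (singSeriesExcl L D)) := by
  obtain ⟨P, hP⟩ := exists_forall_omegaL_eq_card hadm hnd
  have h := singSeriesExcl_bounds_of_forall_omegaL_eq hadm (P₀ := max P (max 1 (2 * k)))
    (le_trans (le_max_left _ _) (le_max_right _ _))
    (le_trans (le_max_right _ _) (le_max_right _ _))
    (fun p hp hlt => hP p hp (lt_of_le_of_lt (le_max_left _ _) hlt)) D
  exact h.1

/-- **`𝔖_D(𝓛) > 0`** for admissible non-degenerate families.
[cite: FordGreenKonyaginMaynardTao2018, (7.6)–(7.7) p. 21; Maynard2016DenseClusters, Prop. 6.1 («𝔖_B(𝓛) ≫ exp(−O(k))»)] -/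
theorem singSeriesExcl_pos_of_nondegenerate {L : Fin k → ℤ × ℤ} (hadm : FormsAdmissible L)
    (hnd : FormsNondegenerate L) (D : ℕ) : 0 < singSeriesExcl L D := by
  obtain ⟨P, hP⟩ := exists_forall_omegaL_eq_card hadm hnd
  have h := singSeriesExcl_bounds_of_forall_omegaL_eq hadm (P₀ := max P (max 1 (2 * k)))
    (le_trans (le_max_left _ _) (le_max_right _ _))
    (le_trans (le_max_right _ _) (le_max_right _ _))
    (fun p hp hlt => hP p hp (lt_of_le_of_lt (le_max_left _ _) hlt)) D
  exact lt_of_lt_of_le (mul_pos (singPartial_pos_of_admissible hadm D _) (Real.exp_pos _)) h.2.1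

end Literature.NumberTheory.Sieve.FGKMT2018
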